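import Summits.QuantumFields.YangMills.Theorems.PoincareLipschitzFlatOrganOfSobolevStubs
import Summits.QuantumFields.YangMills.Theorems.PoincareLipschitzMinimiserMonotonicity
import Summits.QuantumFields.YangMills.Theorems.PoincareLipschitzCompactnessTransferLatticeToContinuumLimitStub
import Summits.QuantumFields.YangMills.Theorems.PoincareLipschitzImproveCoreOfFlat
import Summits.QuantumFields.YangMills.Theorems.PoincareLipschitzImproveOfCore
import Summits.QuantumFields.YangMills.Theorems.PoincareLipschitzOrbitMinHolderRegularityOfImprove
import Summits.QuantumFields.YangMills.Theorems.PoincareLipschitzMedianCentringLinearTail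
import Summits.QuantumFields.YangMills.Theorems.PoincareLipschitzUniformSmallScaleEnergyOfTangentMaps
import Literature.Analysis.PDE.HarmonicMapMinimisers
import HarnessLib

/-!
# Crux `HistoryTailL` (stmt-QuantumFields-19936) BY NAME, modulo {K1-exp, TWO NAMED PRINT FACTS, THE QUANTILE ROW (Q)} —
# FILE K-12: the K2 display v8 «THE FIRST-MOMENT ROW IS A QUANTILE» (+ the tangent-map face: (RS) ↦ (TM))

Cell `ym3-torus` (YM ladder rung R3 = continuum SU(2) Yang–Mills on T³ — a RUNG, NOT the Clay problem: not d = 4, not infinite volume, not a mass gap);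
LEAD seat `ym-ust-19936-w1` g10.  Helper `--supports stmt-QuantumFields-19936`; THEOREMS ONLY; ONE composition by landed names: px10 g6's LINE 27
«MEDIAN CENTRING» door ✓`PoincareLipschitz.MedianCentring.historyTailL_of_expConcentration_quantile (hC : K1-exp) (hLip : BlockLipschitzL) (hQ : (Q))`
fed with the K2 organ `BlockLipschitzL` as the tree now proves it modulo two named printed theorems: ✓K-3 `blockLipschitzL_of_hImprove` ∘ ✓K-4b
`hImprove_of_core` ∘ ✓K-5 `hImproveCore_of_flat` ∘ ✓K-8a `hImproveCoreFlat_of_stubs` ∘ (★w3 ✓`uniformSmallScaleEnergy_band_of_compactness_smoothness hC hR`,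
px3 ✓STUB `stub_latticeToContinuumLimit`); and the same with ★px3 g9's (TM) re-cut ✓p729130
`PoincareLipschitzUniformSmallScaleEnergyOfTangentMaps.uniformSmallScaleEnergy_band_of_compactness_tangentMaps (hCpt) (hTM)` in place of ★w3's door — the
interior-regularity fact (RS) [SU84 Thm] replaced by the TANGENT-MAP row (TM) [SU84 Prop. 1.2: a radially constant member of the class is constant], the
blow-up ∕ monotonicity-equality ∕ zero-density analysis being THEOREMS of the tree (px3 g9 TM-A…E, w2 g13 δ1, ★w3 g15 (M)).

THE DISPLAYED BINDERS.  `hK1` = K1-exp (v2–v7's binder VERBATIM = T-6's `hC` 884∕884); `hC : Literature.Analysis.PDE.MinimisingMapCompactness` [Luckhaus 1988 ∕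
Simon 1996 §2.9 Lemma 1] and `hR : Literature.Analysis.PDE.MinimisingMapSmoothness` [Schoen–Uhlenbeck 1984] (NAMED FACTS ✓p723396); `hQ` = (Q) = LINE 27
`stub_quantileDeviation` VERBATIM (registered on stmt-QuantumFields-23133): the 3∕4-QUANTILE bound `Gibbs_K{dist1(Ū^j(∂a)) ≤ θ(K−j)∕8} ≥ 3∕4` at depths
`1 ≤ j ≤ K − 2` — a CONSEQUENCE of the crux `MeanDeviationL` (stmt-QuantumFields-23083; Markov at profile `b₀∕16`, `θ` linear in `b₀`), hence a WEAKER
displayed row than v7's `hM`.  `hT : Literature.Analysis.PDE.MinimisingTangentMapConstant` [SchoenUhlenbeck1984, Prop. 1.2] (NAMED FACT, ★w3 g15 ✓p729620; body == ★px3 g9's frozen (TM) binder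
1521∕1521).  Census v7 → v8: removed [hM] · added [hQ] · changed [] (face `_of_facts_quantile`); face `_of_compactness_tangentMaps_quantile`: additionally
removed [hR] · added [hT].  NOTHING of K1-exp, the three named facts or (Q) is proved here; `HistoryTailL` is NOT proved.

WHAT IS PROVED (ns `…Theorems.PoincareLipschitzHistoryTailOfFactsQuantile`).
* ★★★ `blockLipschitzL_of_facts (hC) (hR) : PoincareLipschitz.BlockLipschitzL` — the K2 crux (stmt-QuantumFields-23533) modulo the two named facts, Theorems-side.
* ★★★ `historyTailL_of_facts_quantile (hK1) (hC) (hR) (hQ) : UnitScaleTilt.HistoryTailL`.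
* ★★★ `blockLipschitzL_of_compactness_tangentMaps (hC) (hT) : PoincareLipschitz.BlockLipschitzL` and
  ★★★ `historyTailL_of_compactness_tangentMaps_quantile (hK1) (hC) (hT) (hQ) : UnitScaleTilt.HistoryTailL` — the tangent-map faces (three ∕ four NAMED rows).
HONEST SCOPE.  Compositions by landed names only; YM₃ on T³ is rung R3, not Clay; YM gap NOT proved.

References: T. Bałaban, CMP 102 (1985) 255–275 [Balaban1985UV3] ((7) p.257, (71) p.273); T. Bałaban, CMP 98 (1985) 17–51 [Balaban1985Averaging];
L. Simon (1996) [Simon1996]; S. Luckhaus (1988) [Luckhaus1988]; R. Schoen, K. Uhlenbeck, Invent. Math. 78 (1984) [SchoenUhlenbeck1984].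
-/

set_option autoImplicit false

noncomputable section

namespace Summit.QuantumFields.YangMills.Theorems.PoincareLipschitzHistoryTailOfFactsQuantile

open MeasureTheory Filter Topology Finset Metric
open scoped BigOperators
open Literature.Analysis.FunctionSpaces
open Literature.Analysis.PDE (MinimisingMapCompactness MinimisingMapSmoothness MinimisingTangentMapConstant)
open Literature.MathematicalPhysics.QuantumFieldTheory.Balaban1983to89
open Literature.MathematicalPhysics.QuantumFieldTheory.Balaban1983to89.T3ContinuumYM3Torus
open Literature.MathematicalPhysics.QuantumFieldTheory.Balaban1983to89.T3UnitScaleTilt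
open Literature.MathematicalPhysics.QuantumFieldTheory.Balaban1983to89.T3UnitLawDensityEML (ℰp)
open B4Eq19LatticeOperators (Zd box unitVec)
open Summit.QuantumFields.YangMills.Theorems.PoincareLipschitzFlatOrganOfSobolevStubs (hImproveCoreFlat_of_stubs)
open Summit.QuantumFields.YangMills.Theorems.PoincareLipschitzMinimiserMonotonicity (uniformSmallScaleEnergy_band_of_compactness_smoothness)
open Summit.QuantumFields.YangMills.Theorems.PoincareLipschitzCompactnessTransferLatticeToContinuumLimitStub (stub_latticeToContinuumLimit)
open Summit.QuantumFields.YangMills.Theorems.PoincareLipschitzImproveCoreOfFlat (hImproveCore_of_flat)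
open Summit.QuantumFields.YangMills.Theorems.PoincareLipschitzImproveOfCore (hImprove_of_core)
open Summit.QuantumFields.YangMills.Theorems.PoincareLipschitzOrbitMinHolderRegularityOfImprove (blockLipschitzL_of_hImprove)
open Summit.QuantumFields.YangMills.Theorems.PoincareLipschitz.MedianCentring (historyTailL_of_expConcentration_quantile)
open Summit.QuantumFields.YangMills.Theorems.PoincareLipschitzUniformSmallScaleEnergyOfTangentMaps (uniformSmallScaleEnergy_band_of_compactness_tangentMaps)

/-- ★★★ **THE K2 CRUX `BlockLipschitzL` (stmt-QuantumFields-23533) MODULO THE TWO NAMED FACTS, Theorems-side** — K-3 ∘ K-4b ∘ K-5 ∘ K-8a over ★w3's S1″ door and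
px3's S2♭″ stub. [cite: Simon1996, §2.9 Lemma 1; SchoenUhlenbeck1984, Thm; Balaban1985Averaging, Prop. 1] -/
theorem blockLipschitzL_of_facts (hC : MinimisingMapCompactness) (hR : MinimisingMapSmoothness) :
    Summit.QuantumFields.YangMills.Theses.PoincareLipschitz.BlockLipschitzL :=
  blockLipschitzL_of_hImprove (hImprove_of_core (hImproveCore_of_flat
    (hImproveCoreFlat_of_stubs (uniformSmallScaleEnergy_band_of_compactness_smoothness hC hR) stub_latticeToContinuumLimit)))

/-- ★★★ **THE CRUX BY NAME FROM K1-exp, THE NAMED FACTS `MinimisingMapCompactness` ∕ `MinimisingMapSmoothness` AND THE QUANTILE ROW (Q)** (display v8).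
[cite: Balaban1985UV3, (71) p.273; Simon1996, §2.9 Lemma 1; SchoenUhlenbeck1984, Thm] -/
theorem historyTailL_of_facts_quantile
    (hK1 : ∀ (L : ℕ), ∃ (Cc cc : ℝ), 0 ≤ Cc ∧ 0 < cc ∧ ∃ γ₁ : ℝ, 0 < γ₁ ∧ γ₁ ≤ 1 ∧
      ∀ (F : T3Family) (γ : ℝ), F.L = L → 0 < γ → γ ≤ γ₁ → ∀ (K n : ℕ), 1 ≤ n →
        (n : ℝ) ≤ (F.scheme ℰp γ).β K → 2 * n ≤ (F.P K).sitesPerDir 0 →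
        ∀ (x₀ : Site (F.P K) 0) (f : GaugeField (F.P K) 0 (Matrix.specialUnitaryGroup (Fin 2) ℂ) → ℝ) (Λ : ℝ), 0 < Λ →
          Measurable f → GaugeField.GaugeInvariant f →
          (∀ U U' : GaugeField (F.P K) 0 (Matrix.specialUnitaryGroup (Fin 2) ℂ),
            (∀ b : PBond (F.P K) 0, (∀ k, (b.src k - x₀ k).val < n) → (∀ k, (b.tgt k - x₀ k).val < n) → U b = U' b) →
              f U = f U') →
          (∀ U U' : GaugeField (F.P K) 0 (Matrix.specialUnitaryGroup (Fin 2) ℂ),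
            |f U - f U'| ≤ Λ * Real.sqrt (∑ b : PBond (F.P K) 0, GaugeGroup.dist1 (U b * (U' b)⁻¹) ^ 2)) →
          ∀ r : ℝ, 0 ≤ r →
            (gibbsK F ℰp γ K).real {U | r ≤ f U - ∫ V, f V ∂(gibbsK F ℰp γ K)} ≤
              Cc * Real.exp (-(cc * Real.sqrt ((F.scheme ℰp γ).β K) * r / ((n : ℝ) * Λ))))
    (hC : MinimisingMapCompactness) (hR : MinimisingMapSmoothness)
    (hQ : ∀ (L : ℕ) (b₀ p₀ : ℝ), 0 < b₀ → 2 < p₀ → ∃ γ₁ : ℝ, 0 < γ₁ ∧ γ₁ ≤ 1 ∧ ∀ (F : T3Family) (γ : ℝ), F.L = L → 0 < γ → γ ≤ γ₁ →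
            ∀ (K j : ℕ), 1 ≤ j → j + 2 ≤ K → ∀ a : Plaq (F.P K) j,
              3 / 4 ≤ (gibbsK F ℰp γ K).real {U : GaugeField (F.P K) 0 (Matrix.specialUnitaryGroup (Fin 2) ℂ) | GaugeGroup.dist1 (GaugeField.plaqHol (Averaging.iter (fun i' => BlockAveraging.blockAvg (P := F.P K) (j := i') ℰp) j U) a) ≤ θBal F.L γ b₀ p₀ (K - j) / 8})
    : Summit.QuantumFields.YangMills.Theses.UnitScaleTilt.HistoryTailL :=
  historyTailL_of_expConcentration_quantile hK1 (blockLipschitzL_of_facts hC hR) hQ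

/-- ★★★ **THE K2 CRUX `BlockLipschitzL` MODULO THE NAMED FACTS `MinimisingMapCompactness` ∕ `MinimisingTangentMapConstant`** — as `blockLipschitzL_of_facts` with ★px3 g9's tangent-map door in place of the
smoothness fact. [cite: Simon1996, §2.9 Lemma 1; SchoenUhlenbeck1984, Prop. 1.2; Balaban1985Averaging, Prop. 1] -/
theorem blockLipschitzL_of_compactness_tangentMaps (hC : MinimisingMapCompactness)
    (hT : MinimisingTangentMapConstant)
    : Summit.QuantumFields.YangMills.Theses.PoincareLipschitz.BlockLipschitzL :=
  blockLipschitzL_of_hImprove (hImprove_of_core (hImproveCore_of_flat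
    (hImproveCoreFlat_of_stubs (uniformSmallScaleEnergy_band_of_compactness_tangentMaps hC hT) stub_latticeToContinuumLimit)))

/-- ★★★ **THE CRUX BY NAME FROM K1-exp, THE NAMED FACTS `MinimisingMapCompactness` ∕ `MinimisingTangentMapConstant` AND THE QUANTILE ROW (Q)** (display v8,
tangent-map face). [cite: Balaban1985UV3, (71) p.273; Simon1996, §2.9 Lemma 1; SchoenUhlenbeck1984, Prop. 1.2] -/
theorem historyTailL_of_compactness_tangentMaps_quantile
    (hK1 : ∀ (L : ℕ), ∃ (Cc cc : ℝ), 0 ≤ Cc ∧ 0 < cc ∧ ∃ γ₁ : ℝ, 0 < γ₁ ∧ γ₁ ≤ 1 ∧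
      ∀ (F : T3Family) (γ : ℝ), F.L = L → 0 < γ → γ ≤ γ₁ → ∀ (K n : ℕ), 1 ≤ n →
        (n : ℝ) ≤ (F.scheme ℰp γ).β K → 2 * n ≤ (F.P K).sitesPerDir 0 →
        ∀ (x₀ : Site (F.P K) 0) (f : GaugeField (F.P K) 0 (Matrix.specialUnitaryGroup (Fin 2) ℂ) → ℝ) (Λ : ℝ), 0 < Λ →
          Measurable f → GaugeField.GaugeInvariant f →
          (∀ U U' : GaugeField (F.P K) 0 (Matrix.specialUnitaryGroup (Fin 2) ℂ),
            (∀ b : PBond (F.P K) 0, (∀ k, (b.src k - x₀ k).val < n) → (∀ k, (b.tgt k - x₀ k).val < n) → U b = U' b) →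
              f U = f U') →
          (∀ U U' : GaugeField (F.P K) 0 (Matrix.specialUnitaryGroup (Fin 2) ℂ),
            |f U - f U'| ≤ Λ * Real.sqrt (∑ b : PBond (F.P K) 0, GaugeGroup.dist1 (U b * (U' b)⁻¹) ^ 2)) →
          ∀ r : ℝ, 0 ≤ r →
            (gibbsK F ℰp γ K).real {U | r ≤ f U - ∫ V, f V ∂(gibbsK F ℰp γ K)} ≤
              Cc * Real.exp (-(cc * Real.sqrt ((F.scheme ℰp γ).β K) * r / ((n : ℝ) * Λ))))
    (hC : MinimisingMapCompactness)
    (hT : MinimisingTangentMapConstant)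
    (hQ : ∀ (L : ℕ) (b₀ p₀ : ℝ), 0 < b₀ → 2 < p₀ → ∃ γ₁ : ℝ, 0 < γ₁ ∧ γ₁ ≤ 1 ∧ ∀ (F : T3Family) (γ : ℝ), F.L = L → 0 < γ → γ ≤ γ₁ →
            ∀ (K j : ℕ), 1 ≤ j → j + 2 ≤ K → ∀ a : Plaq (F.P K) j,
              3 / 4 ≤ (gibbsK F ℰp γ K).real {U : GaugeField (F.P K) 0 (Matrix.specialUnitaryGroup (Fin 2) ℂ) | GaugeGroup.dist1 (GaugeField.plaqHol (Averaging.iter (fun i' => BlockAveraging.blockAvg (P := F.P K) (j := i') ℰp) j U) a) ≤ θBal F.L γ b₀ p₀ (K - j) / 8})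
    : Summit.QuantumFields.YangMills.Theses.UnitScaleTilt.HistoryTailL :=
  historyTailL_of_expConcentration_quantile hK1 (blockLipschitzL_of_compactness_tangentMaps hC hT) hQ

end Summit.QuantumFields.YangMills.Theorems.PoincareLipschitzHistoryTailOfFactsQuantile

end
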